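import Literature.MathematicalPhysics.QuantumFieldTheory.Balaban1983to89.Node00.Record13SepCoPH
import Literature.MathematicalPhysics.QuantumFieldTheory.Balaban1983to89.DagBinding

/-!
# BalabanUVNodes ∕ N13 — THE COST OF REPAIR ROAD (a) AT THE `B16.Construction` LEVEL: [III] Cor. 3 (2.50) in the `dV`-a.e. currency ⟺ (2.50) AS TYPED for a
# construction whose densities are RE-CHOSEN on the null exceptional sets — same `toB12` (hence literally the same `DagBinding.EndpointExistence`), same `χ`, same
# `Sect2Form`, densities `=ᵐ` the given ones level by level; with Theorem 1, `B16.EndStatementBPrinted` of the re-chosen construction; instantiated at NODE 00's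
# Stage-13 datum of record

Cell `pub-ymgap` (HUMAN RULING D-0062 Track A ∕ D-0149 width), WIDTH SEAT `pub-ymgap-dag-n13-w2` (gen 4, CLAIM-2, INBOX l.32277), key K1⁸ `StabilityBRunRowsAtRecordR13SepCoPH` =
stmt-QuantumFields-26907 (route rev 27; its (B) conjunct `B16.EndStatementBPrinted (datumOfRecord₁₃SepCoPH F 2 θ h).C` is K1⁷'s = stmt-QuantumFields-20542's, now `aside`)
(`--kind proof --supports … --as helper`; count-neutral; LOCATED purpose for plan ∕ CRIT-1 ∕ dag-lead's `RECORD13-CLOSABILITY-GATE.md` — NO re-cut asked by this seat).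
[III] = [Balaban1988Convergent], [B16] = [Balaban1989LargeFieldII], [I] = [Balaban1987RG1].

WHY.  dag-n13-w1's p610399 and this seat's p617654 (`…N13Cor3PinsMargDensityVersionAtRecord13` ∕ `…N13Cor3MargDensityVersionNotDeterminedAtRecord13`) locate that the Cor-3 half
of (B) at levels ≥ 1, AS TYPED on `densOfRecord₁₃` (at EVERY field), reads point values of Mathlib's chosen marginal-density version, which its specification does not
determine; the VERSION-FREE currencies (`dV`-a.e. ∕ as measures ∕ integrated) are the ones an estimate can reach.  THIS FILE prices the a.e. currency at the level where
`EndStatementBPrinted` is STATED (`B16.Construction`, whose densities `ρ_k` are free data over the small-field carrier `B12.RunData`): NOTHING provable is lost — the a.e. form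
is implied by the typed form, and conversely every a.e. instance IS a typed instance of a construction differing from the given one only by an a.e. re-choice of `ρ`.  What
does NOT transfer at this level is recorded: def-T's `T4Continuum.Realisation` (`rho_succ_eq`, an equation of FUNCTIONS) — a datum-level transfer needs the tower re-run on the
re-chosen densities, or the rung leaf read in the a.e. currency; the planners' word.

WHAT THIS FILE PROVES (theorems only; 0 `def`; no `instance`, no `notation`; standard axioms; NO route-file import).
§1 [folklore] GENERIC over `C : B16.Construction` and exceptional sets `E P k ⊆ (C P).Cfg k` (measure-free): `uvIneq_barrier_le` (under `χ ≤ 1`, `0 ≤ g⁻²·A`, the LOWER barrier of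
   (2.50) with `em` is `≤` the UPPER barrier with `max ep (−em)`); `uvIneq_mono_ep` (enlarging `ep`); ★ `exists_rho_eqOn_cor3With_of_offSet` — if (2.50) holds OFF `E P k` on the window, the
   densities re-chosen as the upper barrier ON `E P k` satisfy `B16.Cor3With (fun P => {C P with ρ := ρ′ P}) γ em (fun g => max (ep g) (−(em g)))` and agree with the given ones off
   `E`; `toB12_update_rho` (`rfl`), `thm1Printed_update_rho_iff` (`Iff.rfl`), `endpointExistence_update_rho_iff` (`Iff.rfl`: K2⁸ ∕ K3⁷'s `DagBinding.EndpointExistence ….toB12`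
   is LITERALLY unchanged), ★★ `exists_rho_eqOn_endStatementBPrinted_of_thm1_of_offSet`.
§2 AT THE DATUM OF RECORD (`Node00.datumOfRecord₁₃SepCoPH F N θ h`, any `N`; faces `χ = chiFix29OfRecord ≤ 1`, `A^η ≥ 0` by `chiFix29OfRecord_mem_Icc` ∕ `wilsonBGOfRecord_nonneg`):
   `ae_uvIneq_of_cor3With_datum` (typed ⇒ `dV`-a.e., trivially) and ★★★ `exists_rho_ae_eq_endStatementBPrinted_datum_of_thm1_of_ae` — Theorem 1 at the datum + (2.50) `dV`-A.E. on
   the window ⟹ densities `ρ′ P k =ᵐ[dV] ((datum).C P).ρ k` (EVERY `P`, `k`) with `B16.EndStatementBPrinted (fun P => {(datum).C P with ρ := ρ′ P})`, whose `toB12` is the datum's.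
§3 CONSUMER FORM: `uvIneq_at_record₁₃SepCoPH_iff` (`Iff.rfl` face in record letters) and ★★★ `exists_rho_ae_eq_endStatementBPrinted_datum_of_thm1_of_aeRow` — Theorem 1 at the datum + the K1
   ENGINES' N13 row `hUV` (dag-n12-d ∕ dag-n24-c letters: window, `SLaw₁₃CoPH` guard, `em`∕`ep` of `g_k`) with «every `U`» replaced by «`dV`-a.e. `U`» ⟹ the same conclusion; the `SLaw`
   guard is paid by Theorem 1 on `]0, min γ γ₁]`.

HONEST FRAMING.  Count-neutral bookkeeping (an `if-then-else` re-choice of a real-valued function on a set; `Filter.EventuallyEq` off a null set); nothing of Bałaban's asserted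
or refuted; K1⁸ ∕ K1⁷ NEITHER proved NOR refuted; NO datum-level or rung-level transfer claimed; N13 NOT discharged; no stub closed; counts unmoved (typed 28∕28 · discharged 5∕27 ·
A 5∕28); one finite `𝕋⁴_{L^K}` programme at fixed `ε = L^{−K}`, Bałaban AS PRINTED; route R4 closes the CONDITIONAL finite-𝕋⁴ rung `BalabanLadder.UV` only — the Yang–Mills mass
gap (Clay) is NOT proved by any of this; nothing continuum ∕ ℝ⁴ ∕ OS.  No `sorry`.
-/

noncomputable section

open scoped ENNReal

namespace Summit.QuantumFields.YangMills.BalabanUVNodes.N13Cor3AEIffUpToVersionAtRecord13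

open MeasureTheory Set
open Literature.MathematicalPhysics.QuantumFieldTheory.Balaban1983to89
open Literature.MathematicalPhysics.QuantumFieldTheory.Balaban1983to89.T4Continuum (T4Family)
open Literature.MathematicalPhysics.QuantumFieldTheory.Balaban1983to89.Node00

/-! ## §1 GENERIC: re-choosing the densities of a `B16.Construction` on exceptional sets -/

section Generic

open B16

variable (C : B16.Construction)

/-- **The two barriers of (2.50) are compatible**: `χ·exp(−g⁻²A − em·n) ≤ exp(max ep (−em) · n)` when `χ ≤ 1`, `0 ≤ g⁻²·A` and `0 ≤ n` (no sign of `χ` needed).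
[cite: Balaban1988Convergent, Cor. 3 (2.50) p.264 (bookkeeping)] -/
theorem uvIneq_barrier_le {χ a n em ep : ℝ} (hχ1 : χ ≤ 1) (ha : 0 ≤ a) (hn : 0 ≤ n) :
    χ * Real.exp (-a - em * n) ≤ Real.exp (max ep (-em) * n) := by
  have h1 : Real.exp (-a - em * n) ≤ Real.exp (max ep (-em) * n) := by
    apply Real.exp_le_exp.mpr
    have : -em * n ≤ max ep (-em) * n := mul_le_mul_of_nonneg_right (le_max_right _ _) hn
    linarith
  calc χ * Real.exp (-a - em * n) ≤ 1 * Real.exp (-a - em * n) :=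
        mul_le_mul_of_nonneg_right hχ1 (Real.exp_pos _).le
    _ ≤ Real.exp (max ep (-em) * n) := by rw [one_mul]; exact h1

/-- **Enlarging the upper constant keeps (2.50).** [cite: Balaban1988Convergent, Cor. 3 (2.50) p.264 (bookkeeping)] -/
theorem uvIneq_mono_ep (D : B16.RunData) (k : ℕ) (V : D.Cfg k) {Em Ep Ep' : ℝ} (hE : Ep ≤ Ep') (h : UVIneq D k V Em Ep) : UVIneq D k V Em Ep' :=
  ⟨h.1, h.2.trans (Real.exp_le_exp.mpr (mul_le_mul_of_nonneg_right hE (Nat.cast_nonneg _)))⟩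

/-- The construction with its densities replaced (`{C P with ρ := ρ′ P}`) has the SAME small-field carrier: `toB12` is literally unchanged (`rfl`).
[cite: Balaban1988Convergent, Thm 1 p.262 (bookkeeping)] -/
theorem toB12_update_rho (ρ' : (P : B12.RunParams) → (k : ℕ) → (C P).Cfg k → ℝ) :
    B16.Construction.toB12 (fun P => { C P with ρ := ρ' P }) = C.toB12 := rfl

/-- … hence the SAME `DagBinding.EndpointExistence` (K2⁸ ∕ K3⁷'s other input reads `toB12` only; `Iff.rfl`). [cite: Balaban1987RG1, Thm 2 p.259 (bookkeeping)] -/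
theorem endpointExistence_update_rho_iff (ρ' : (P : B12.RunParams) → (k : ℕ) → (C P).Cfg k → ℝ) :
    DagBinding.EndpointExistence (B16.Construction.toB12 (fun P => { C P with ρ := ρ' P })) ↔ DagBinding.EndpointExistence C.toB12 := Iff.rfl

/-- … and the SAME Theorem-1 sentence (`Sect2Form` and the flow are untouched; `Iff.rfl`). [cite: Balaban1989LargeFieldII, Thm 1 p.355 (bookkeeping)] -/
theorem thm1Printed_update_rho_iff (ρ' : (P : B12.RunParams) → (k : ℕ) → (C P).Cfg k → ℝ) :
    Thm1Printed (fun P => { C P with ρ := ρ' P }) ↔ Thm1Printed C := Iff.rfl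

open Classical in
/-- **★ (2.50) OFF EXCEPTIONAL SETS ⟹ (2.50) AS TYPED FOR RE-CHOSEN DENSITIES.**  Let `E P k ⊆ (C P).Cfg k` and suppose the two-sided bound (2.50) with `em, ep` holds at every
windowed run, every `k ≤ K` and every field OFF `E P k`.  Re-choose `ρ′ P k V :=` the upper barrier `exp(max (ep g_k) (−em g_k) · |T₁^{(k)}|)` on `E P k` and `:= ρ_k(V)` off it.  Then
`ρ′` agrees with `ρ` off `E`, and `B16.Cor3With (fun P => {C P with ρ := ρ′ P}) γ em (fun g => max (ep g) (−(em g)))` — given `χ ≤ 1` and `0 ≤ A^η`.  Pure bookkeeping.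
[cite: Balaban1988Convergent, Cor. 3 (2.50) p.264; Balaban1989LargeFieldII, (0.1) pp.355–356 (bookkeeping)] -/
theorem exists_rho_eqOn_cor3With_of_offSet (E : (P : B12.RunParams) → (k : ℕ) → Set ((C P).Cfg k))
    (hχ : ∀ P k V, (C P).χ k V ≤ 1) (hA : ∀ P k V, 0 ≤ (C P).wilsonBG k V) {γ : ℝ} {em ep : ℝ → ℝ}
    (hoff : ∀ P : B12.RunParams, (C P).flow.InInterval γ P.K → ∀ k, k ≤ P.K → ∀ V, V ∉ E P k →
      UVIneq (C P) k V (em ((C P).flow.g k)) (ep ((C P).flow.g k))) :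
    ∃ ρ' : (P : B12.RunParams) → (k : ℕ) → (C P).Cfg k → ℝ,
      (∀ P k V, V ∉ E P k → ρ' P k V = (C P).ρ k V) ∧
        Cor3With (fun P => { C P with ρ := ρ' P }) γ em (fun g => max (ep g) (-(em g))) := by
  refine ⟨fun P k V => if V ∈ E P k then Real.exp (max (ep ((C P).flow.g k)) (-(em ((C P).flow.g k))) * ((C P).numSites k : ℝ)) else (C P).ρ k V,
    fun P k V hV => if_neg hV, fun P hP k hk V => ?_⟩
  by_cases hV : V ∈ E P k
  · refine ⟨?_, ?_⟩
    · show (C P).χ k V * Real.exp (-(1 / ((C P).flow.g k) ^ 2 * (C P).wilsonBG k V) - em ((C P).flow.g k) * ((C P).numSites k : ℝ)) ≤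
        (if V ∈ E P k then Real.exp (max (ep ((C P).flow.g k)) (-(em ((C P).flow.g k))) * ((C P).numSites k : ℝ)) else (C P).ρ k V)
      rw [if_pos hV]
      exact uvIneq_barrier_le (hχ P k V) (mul_nonneg (by positivity) (hA P k V)) (Nat.cast_nonneg _)
    · show (if V ∈ E P k then Real.exp (max (ep ((C P).flow.g k)) (-(em ((C P).flow.g k))) * ((C P).numSites k : ℝ)) else (C P).ρ k V) ≤
        Real.exp (max (ep ((C P).flow.g k)) (-(em ((C P).flow.g k))) * ((C P).numSites k : ℝ))
      rw [if_pos hV]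
  · have h := uvIneq_mono_ep (C P) k V (le_max_left (ep ((C P).flow.g k)) (-(em ((C P).flow.g k)))) (hoff P hP k hk V hV)
    refine ⟨?_, ?_⟩
    · show _ ≤ (if V ∈ E P k then _ else (C P).ρ k V)
      rw [if_neg hV]
      exact h.1
    · show (if V ∈ E P k then _ else (C P).ρ k V) ≤ _
      rw [if_neg hV]
      exact h.2

/-- **★★ WITH THEOREM 1: `EndStatementBPrinted` OF THE RE-CHOSEN CONSTRUCTION** (Theorem-1 sentence unchanged, Cor. 3 from §1 with `γ`, `em`, `max ep (−em)`); densities agree with the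
given ones off the exceptional sets.  [cite: Balaban1989LargeFieldII, Thm 1 p.355, (0.1) pp.355–356, p.391; Balaban1988Convergent, Cor. 3 (2.50) p.264 (bookkeeping)] -/
theorem exists_rho_eqOn_endStatementBPrinted_of_thm1_of_offSet (E : (P : B12.RunParams) → (k : ℕ) → Set ((C P).Cfg k))
    (hχ : ∀ P k V, (C P).χ k V ≤ 1) (hA : ∀ P k V, 0 ≤ (C P).wilsonBG k V) (h1 : Thm1Printed C) {γ : ℝ} (hγ : 0 < γ) {em ep : ℝ → ℝ}
    (hoff : ∀ P : B12.RunParams, (C P).flow.InInterval γ P.K → ∀ k, k ≤ P.K → ∀ V, V ∉ E P k →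
      UVIneq (C P) k V (em ((C P).flow.g k)) (ep ((C P).flow.g k))) :
    ∃ ρ' : (P : B12.RunParams) → (k : ℕ) → (C P).Cfg k → ℝ,
      (∀ P k V, V ∉ E P k → ρ' P k V = (C P).ρ k V) ∧ EndStatementBPrinted (fun P => { C P with ρ := ρ' P }) := by
  obtain ⟨ρ', hoffE, hcor⟩ := exists_rho_eqOn_cor3With_of_offSet C E hχ hA hoff
  exact ⟨ρ', hoffE, (thm1Printed_update_rho_iff C ρ').mpr h1, γ, hγ, em, _, hcor⟩

end Generic

/-! ## §2 AT NODE 00's STAGE-13 DATUM OF RECORD: the a.e. Cor. 3 is the typed Cor. 3 of a construction with a.e.-equal densities -/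

section Record

variable (F : T4Family) (N : ℕ) [NeZero N] (θ : Stage13HParams F N) (h : θ.Provisos₁₃SepCoPH F N)

/-- **Typed ⟹ a.e.** (trivially, for the product Haar measure or any other): (2.50) at every field gives (2.50) `dV`-a.e. [cite: Balaban1988Convergent, Cor. 3 (2.50) p.264 (bookkeeping)] -/
theorem ae_uvIneq_of_cor3With_datum {γ : ℝ} {em ep : ℝ → ℝ} (hcor : B16.Cor3With (datumOfRecord₁₃SepCoPH F N θ h).C γ em ep) (P : B12.RunParams)
    (hP : ((datumOfRecord₁₃SepCoPH F N θ h).C P).flow.InInterval γ P.K) (k : ℕ) (hk : k ≤ P.K) :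
    ∀ᵐ V ∂(fieldMeasure (F.P P.K) k (SU N)),
      B16.UVIneq ((datumOfRecord₁₃SepCoPH F N θ h).C P) k V (em (((datumOfRecord₁₃SepCoPH F N θ h).C P).flow.g k)) (ep (((datumOfRecord₁₃SepCoPH F N θ h).C P).flow.g k)) :=
  Filter.Eventually.of_forall fun V => hcor P hP k hk V

/-- The sign faces of the datum's construction: `χ_k ≤ 1` (the (2.9) cut-off `chiFix29OfRecord ∈ {0,1}`) and `0 ≤ A^η(U_k(V))` (`wilsonBGOfRecord_nonneg`).
[cite: Balaban1987RG1, (2.9) p.266, (0.2) p.252 (bookkeeping)] -/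
theorem signs_datum (P : B12.RunParams) (k : ℕ) (V : ((datumOfRecord₁₃SepCoPH F N θ h).C P).Cfg k) :
    ((datumOfRecord₁₃SepCoPH F N θ h).C P).χ k V ≤ 1 ∧ 0 ≤ ((datumOfRecord₁₃SepCoPH F N θ h).C P).wilsonBG k V :=
  ⟨(chiFix29OfRecord_mem_Icc θ.ν θ.ε₂₉ P.K k V).2, wilsonBGOfRecord_nonneg F N θ.εbg P k V⟩

open Classical in
/-- **★★★ THEOREM 1 AT THE DATUM + (2.50) `dV`-A.E. ON THE WINDOW ⟹ `EndStatementBPrinted` OF A CONSTRUCTION WITH A.E.-EQUAL DENSITIES, SAME `toB12`, SAME `χ`, SAME `Sect2Form`.**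
For `θ : Stage13HParams`, `h : Provisos₁₃SepCoPH`, any `N`: if `B16.Thm1Printed (datum).C` and, for some `γ > 0` and `em, ep`, (2.50) holds `dV`-a.e. at every windowed run and every
`k ≤ K`, then there are densities `ρ′ P k =ᵐ[dV] ((datum).C P).ρ k` for EVERY `P, k` (off the window nothing is changed) with `B16.EndStatementBPrinted (fun P => {(datum).C P with ρ := ρ′ P})`
— the (B) conjunct AS TYPED, for a construction whose small-field part `toB12` (hence `DagBinding.EndpointExistence`, §1) IS the datum's.  The exceptional sets are the null sets where the
a.e. hypothesis fails; `ρ′` is the upper barrier there.  NOT claimed: that `ρ′` is def-T's tower of a re-chosen version (def-T's `Realisation.rho_succ_eq` is an equation of functions) — a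
datum-level ∕ rung-level transfer is the planners' matter.  [cite: Balaban1989LargeFieldII, Thm 1 p.355, (0.1) pp.355–356; Balaban1988Convergent, Cor. 3 (2.50) p.264 (bookkeeping)] -/
theorem exists_rho_ae_eq_endStatementBPrinted_datum_of_thm1_of_ae (h1 : B16.Thm1Printed (datumOfRecord₁₃SepCoPH F N θ h).C) {γ : ℝ} (hγ : 0 < γ) {em ep : ℝ → ℝ}
    (hae : ∀ P : B12.RunParams, ((datumOfRecord₁₃SepCoPH F N θ h).C P).flow.InInterval γ P.K → ∀ k, k ≤ P.K →
      ∀ᵐ V ∂(fieldMeasure (F.P P.K) k (SU N)),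
        B16.UVIneq ((datumOfRecord₁₃SepCoPH F N θ h).C P) k V (em (((datumOfRecord₁₃SepCoPH F N θ h).C P).flow.g k)) (ep (((datumOfRecord₁₃SepCoPH F N θ h).C P).flow.g k))) :
    ∃ ρ' : (P : B12.RunParams) → (k : ℕ) → GaugeField (F.P P.K) k (SU N) → ℝ,
      (∀ P k, ρ' P k =ᵐ[fieldMeasure (F.P P.K) k (SU N)] ((datumOfRecord₁₃SepCoPH F N θ h).C P).ρ k) ∧
        B16.EndStatementBPrinted (fun P => { (datumOfRecord₁₃SepCoPH F N θ h).C P with ρ := ρ' P }) := by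
  -- the exceptional sets: inside the window, where (2.50) fails; outside it, nothing
  let E : (P : B12.RunParams) → (k : ℕ) → Set (GaugeField (F.P P.K) k (SU N)) := fun P k =>
    {V | ((datumOfRecord₁₃SepCoPH F N θ h).C P).flow.InInterval γ P.K ∧ k ≤ P.K ∧
      ¬ B16.UVIneq ((datumOfRecord₁₃SepCoPH F N θ h).C P) k V (em (((datumOfRecord₁₃SepCoPH F N θ h).C P).flow.g k))
        (ep (((datumOfRecord₁₃SepCoPH F N θ h).C P).flow.g k))}
  have hnull : ∀ P k, fieldMeasure (F.P P.K) k (SU N) (E P k) = 0 := by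
    intro P k
    by_cases hP : ((datumOfRecord₁₃SepCoPH F N θ h).C P).flow.InInterval γ P.K ∧ k ≤ P.K
    · have hae' := hae P hP.1 k hP.2
      rw [Filter.Eventually, mem_ae_iff] at hae'
      refine measure_mono_null (fun V hV => ?_) hae'
      exact hV.2.2
    · have hE : E P k = ∅ := Set.eq_empty_iff_forall_notMem.mpr fun V hV => hP ⟨hV.1, hV.2.1⟩
      rw [hE, measure_empty]
  have hoff : ∀ P : B12.RunParams, ((datumOfRecord₁₃SepCoPH F N θ h).C P).flow.InInterval γ P.K → ∀ k, k ≤ P.K → ∀ V, V ∉ E P k →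
      B16.UVIneq ((datumOfRecord₁₃SepCoPH F N θ h).C P) k V (em (((datumOfRecord₁₃SepCoPH F N θ h).C P).flow.g k))
        (ep (((datumOfRecord₁₃SepCoPH F N θ h).C P).flow.g k)) := by
    intro P hP k hk V hV
    by_contra hc
    exact hV ⟨hP, hk, hc⟩
  obtain ⟨ρ', hoffE, hB⟩ := exists_rho_eqOn_endStatementBPrinted_of_thm1_of_offSet (datumOfRecord₁₃SepCoPH F N θ h).C E
    (fun P k V => (signs_datum F N θ h P k V).1) (fun P k V => (signs_datum F N θ h P k V).2) h1 hγ hoff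
  refine ⟨ρ', fun P k => ?_, hB⟩
  filter_upwards [measure_eq_zero_iff_ae_notMem.1 (hnull P k)] with V hV
  exact hoffE P k V hV

end Record

/-! ## §3 CONSUMER FORM: Theorem 1 at the datum + the ENGINES' `hUV` ROW IN THE `dV`-A.E. CURRENCY ⟹ (B) of an a.e.-re-chosen construction -/

section Row

variable (F : T4Family) (N : ℕ) [NeZero N] (θ : Stage13HParams F N) (h : θ.Provisos₁₃SepCoPH F N)

/-- **(2.50) at the datum IS the record-letters two-sided bound** (`rfl` through `datumOfRecord₁₃SepCoPH_C` ∕ `RGMachineCore.construction`; the `SepCoPH` twin of dag-n13-a's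
`B16NodeKnitRecord13CoPH.uvIneq_at_record₁₃CoPH_iff`): `χ_k = chiβOfRecord₁₃`, `A^η_k = wilsonBGOfRecord … θ.εbg`, `g_k = gOfRecord₁₃`, `ρ_k = densOfRecord₁₃`, `|T₁^{(k)}| = |Site (F.P P.K) k|`.
[cite: Balaban1989LargeFieldII, (0.1) pp.355–356; Balaban1988Convergent, (2.50) p.264 (bookkeeping)] -/
theorem uvIneq_at_record₁₃SepCoPH_iff (P : B12.RunParams) (k : ℕ) (V : GaugeField (F.P P.K) k (SU N)) (Em Ep : ℝ) :
    B16.UVIneq ((datumOfRecord₁₃SepCoPH F N θ h).C P) k V Em Ep ↔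
      chiβOfRecord₁₃ F N θ.toStage13Params P.K (gOfRecord₁₃ F N θ.toStage13Params P) k V *
            Real.exp (-(1 / (gOfRecord₁₃ F N θ.toStage13Params P k) ^ 2 * wilsonBGOfRecord F N θ.εbg P k V) - Em * (Fintype.card (Site (F.P P.K) k) : ℝ)) ≤
          densOfRecord₁₃ F N θ.toStage13Params P k V ∧
        densOfRecord₁₃ F N θ.toStage13Params P k V ≤ Real.exp (Ep * (Fintype.card (Site (F.P P.K) k) : ℝ)) :=
  Iff.rfl

/-- **★★★ CONSUMER FORM.**  `B16.Thm1Printed (datum).C` (N11's T-row + [IV] selector laws, dag-n13-w1 p583899) AND the K1 engines' N13 row `hUV` with «at every `U`» REPLACED BY «for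
`dV`-almost every `U`» (window `γ`, guard `SLaw₁₃CoPH`, dependence functions `em`, `ep` of `g_k`; the engines' `WorldP` letters `w.γ`, `w.em`, `w.ep` instantiate them) ⟹ densities
`ρ′ P k =ᵐ[dV] densOfRecord₁₃ θ P k` (every `P`, `k`) with `B16.EndStatementBPrinted (fun P => {(datum).C P with ρ := ρ′ P})` — same `toB12`, `χ`, `Sect2Form` as the datum.  The
`SLaw` guard is discharged on the window `]0, min γ γ₁]` by Theorem 1 itself (`Sect2Form = SLaw₁₃CoPH`, `Iff.rfl`).  LOCATED purpose: the a.e. row is the currency an estimate on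
Bałaban's objects can deliver (p610399 ∕ p617654); what it buys at the `B16.Construction` level is the typed (B) up to an a.e. re-choice of `ρ`; the datum ∕ rung level is the planners'.
[cite: Balaban1989LargeFieldII, Thm 1 p.355, (0.1) pp.355–356; Balaban1988Convergent, Thm 1 p.262, Cor. 3 (2.50) p.264 (bookkeeping)] -/
theorem exists_rho_ae_eq_endStatementBPrinted_datum_of_thm1_of_aeRow (h1 : B16.Thm1Printed (datumOfRecord₁₃SepCoPH F N θ h).C) {γ : ℝ} (hγ : 0 < γ) {em ep : ℝ → ℝ}
    (hrow : ∀ P : B12.RunParams, ((datumOfRecord₁₃SepCoPH F N θ h).C P).flow.InInterval γ P.K → ∀ k, k ≤ P.K → SLaw₁₃CoPH F N θ P k →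
      ∀ᵐ U ∂(fieldMeasure (F.P P.K) k (SU N)),
        chiβOfRecord₁₃ F N θ.toStage13Params P.K (gOfRecord₁₃ F N θ.toStage13Params P) k U *
              Real.exp (-(1 / (gOfRecord₁₃ F N θ.toStage13Params P k) ^ 2 * wilsonBGOfRecord F N θ.εbg P k U)
                - em (gOfRecord₁₃ F N θ.toStage13Params P k) * (Fintype.card (Site (F.P P.K) k) : ℝ)) ≤ densOfRecord₁₃ F N θ.toStage13Params P k U ∧
          densOfRecord₁₃ F N θ.toStage13Params P k U ≤ Real.exp (ep (gOfRecord₁₃ F N θ.toStage13Params P k) * (Fintype.card (Site (F.P P.K) k) : ℝ))) :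
    ∃ ρ' : (P : B12.RunParams) → (k : ℕ) → GaugeField (F.P P.K) k (SU N) → ℝ,
      (∀ P k, ρ' P k =ᵐ[fieldMeasure (F.P P.K) k (SU N)] densOfRecord₁₃ F N θ.toStage13Params P k) ∧
        B16.EndStatementBPrinted (fun P => { (datumOfRecord₁₃SepCoPH F N θ h).C P with ρ := ρ' P }) := by
  obtain ⟨γ₁, hγ₁, hS⟩ := h1
  refine exists_rho_ae_eq_endStatementBPrinted_datum_of_thm1_of_ae F N θ h ⟨γ₁, hγ₁, hS⟩ (lt_min hγ hγ₁) (em := em) (ep := ep) fun P hP k hk => ?_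
  have hPγ : ((datumOfRecord₁₃SepCoPH F N θ h).C P).flow.InInterval γ P.K := fun j hj => ⟨(hP j hj).1, (hP j hj).2.trans (min_le_left _ _)⟩
  have hPγ₁ : ((datumOfRecord₁₃SepCoPH F N θ h).C P).flow.InInterval γ₁ P.K := fun j hj => ⟨(hP j hj).1, (hP j hj).2.trans (min_le_right _ _)⟩
  filter_upwards [hrow P hPγ k hk (hS P hPγ₁ k hk)] with U hU
  exact (uvIneq_at_record₁₃SepCoPH_iff F N θ h P k U _ _).mpr hU

end Row

end Summit.QuantumFields.YangMills.BalabanUVNodes.N13Cor3AEIffUpToVersionAtRecord13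

end
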